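import Mathlib
import HarnessLib
import Summits.AtomisticToContinuum.Crystallization.Theorems.PricedLinkCensusSoftFourRingsFourCycle

/-!
# Positive kernels around a pole on `S²` (the three-point kernels of the cap certificate)

Route `PricedLinkCensus`, item `SoftFourRings` (stmt-AtomisticToContinuum-14234), bond-to-cap
step.  For a unit vector `p ∈ S²` ("pole") and unit vectors `x, y` write `u = ⟪p, x⟫`,
`v = ⟪p, y⟫`, `t = ⟪x, y⟫`.  The projections `w_x = x − u p` to `p^⊥ ≅ ℂ` have
`⟪w_x, w_y⟫ = t − uv =: s` and `‖w_x‖²‖w_y‖² = (1 − u²)(1 − v²) =: E`, and, identifying `p^⊥` with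
`ℂ`, `conj(w_x) · w_y = s + iδ` with `s² + δ² = E`.  Hence the polynomials `capQ k s E = Re((s+iδ)^k)`
(two-step recurrence `Q₀ = 1`, `Q₁ = s`, `Q_{k+2} = 2s·Q_{k+1} − E·Q_k`; these are
`((1−u²)(1−v²))^{k/2} T_k(cos φ)`, `φ` the azimuth difference, `T_k` Chebyshev) are POSITIVE
SEMIDEFINITE kernels on the sphere for every fixed pole:
`Σ_{i,j} c_i c_j capQ k (s_ij) (E_ij) = |Σ_i c_i w_i^k|² ≥ 0` (`sum_sum_capQ_nonneg`).  This is the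
`S²` case of the positivity behind Bachoc–Vallentin's three-point bounds, in the elementary form
needed by the certificate of `PricedLinkCensusSoftFourRingsCapCert*`.
-/

namespace Summit.AtomisticToContinuum.Crystallization.Theorems.Cap

open Real RealInnerProductSpace Literature.Geometry.DiscreteGeometry Complex

/-- The polar kernels `capQ k s E = Re((s + iδ)^k)` where `δ² = E − s²`, by the two-step
recurrence `Q₀ = 1`, `Q₁ = s`, `Q_{k+2} = 2s·Q_{k+1} − E·Q_k`. [folklore] -/
noncomputable def capQ : ℕ → ℝ → ℝ → ℝ
  | 0, _, _ => 1
  | 1, s, _ => s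
  | k + 2, s, E => 2 * s * capQ (k + 1) s E - E * capQ k s E

/-- `capQ 0 = 1`. [folklore] -/
@[simp] theorem capQ_zero (s E : ℝ) : capQ 0 s E = 1 := rfl
/-- `capQ 1 = s`. [folklore] -/
@[simp] theorem capQ_one (s E : ℝ) : capQ 1 s E = s := rfl
/-- The recurrence. [folklore] -/
theorem capQ_add_two (k : ℕ) (s E : ℝ) :
    capQ (k + 2) s E = 2 * s * capQ (k + 1) s E - E * capQ k s E := rfl

/-- **`capQ k (Re ζ) |ζ|² = Re (ζ^k)`** for every complex `ζ` (from `ζ² = 2 Re ζ · ζ − |ζ|²`).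
[folklore] -/
theorem capQ_re_normSq (ζ : ℂ) : ∀ k : ℕ, capQ k ζ.re (Complex.normSq ζ) = (ζ ^ k).re
  | 0 => by simp
  | 1 => by simp
  | k + 2 => by
    rw [capQ_add_two, capQ_re_normSq ζ (k + 1), capQ_re_normSq ζ k]
    have h : ζ ^ (k + 2) = 2 * (ζ.re : ℂ) * ζ ^ (k + 1) - (Complex.normSq ζ : ℂ) * ζ ^ k := by
      rw [Complex.normSq_eq_conj_mul_self, Complex.re_eq_add_conj]
      ring
    rw [h]
    simp [Complex.sub_re, Complex.mul_re]

/-- **Positivity of the polar kernels (abstract form).**  For complex numbers `z_i` and real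
weights `c_i`, with `ζ_ij = conj(z_i) z_j` (so `Re ζ_ij = ⟪z_i, z_j⟫_ℝ²`, `|ζ_ij|² = |z_i|²|z_j|²`):
`Σ_{i,j} c_i c_j capQ k (Re ζ_ij) (|z_i|²|z_j|²) = |Σ_i c_i z_i^k|² ≥ 0`. [folklore] -/
theorem sum_sum_capQ_conj_mul_nonneg (k : ℕ) {ι : Type*} (S : Finset ι) (c : ι → ℝ) (z : ι → ℂ) :
    0 ≤ ∑ i ∈ S, ∑ j ∈ S, c i * c j *
      capQ k ((starRingEnd ℂ) (z i) * z j).re (Complex.normSq (z i) * Complex.normSq (z j)) := by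
  have key : ∀ i j, capQ k ((starRingEnd ℂ) (z i) * z j).re (Complex.normSq (z i) * Complex.normSq (z j))
      = ((starRingEnd ℂ) (z i ^ k) * z j ^ k).re := by
    intro i j
    have h1 : Complex.normSq (z i) * Complex.normSq (z j) =
        Complex.normSq ((starRingEnd ℂ) (z i) * z j) := by
      rw [Complex.normSq_mul, Complex.normSq_conj]
    rw [h1, capQ_re_normSq, mul_pow, map_pow]
  simp_rw [key]
  set w : ℂ := ∑ i ∈ S, (c i : ℂ) * z i ^ k with hw
  have hsum : (∑ i ∈ S, ∑ j ∈ S, c i * c j * ((starRingEnd ℂ) (z i ^ k) * z j ^ k).re)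
      = ((starRingEnd ℂ) w * w).re := by
    rw [hw, map_sum, Finset.sum_mul, Complex.re_sum]
    refine Finset.sum_congr rfl fun i _ => ?_
    rw [Finset.mul_sum, Complex.re_sum]
    refine Finset.sum_congr rfl fun j _ => ?_
    rw [map_mul, Complex.conj_ofReal]
    have : ((c i : ℂ) * (starRingEnd ℂ) (z i ^ k) * ((c j : ℂ) * z j ^ k)) =
        ((c i * c j : ℝ) : ℂ) * ((starRingEnd ℂ) (z i ^ k) * z j ^ k) := by
      push_cast; ring
    rw [this, Complex.re_ofReal_mul]
  rw [hsum, ← Complex.normSq_eq_conj_mul_self]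
  exact_mod_cast Complex.normSq_nonneg w

/-- **Positivity of the polar kernels on `S²`.**  For a unit pole `p` and unit vectors `x_i ∈ ℝ³`
with `u_i = ⟪p, x_i⟫`, `t_ij = ⟪x_i, x_j⟫`:
`Σ_{i,j} c_i c_j capQ k (t_ij − u_i u_j) ((1 − u_i²)(1 − u_j²)) ≥ 0`. [folklore] -/
theorem sum_sum_capQ_nonneg (k : ℕ) {ι : Type*} (S : Finset ι) (c : ι → ℝ)
    {p : EuclideanSpace ℝ (Fin 3)} (hp : ‖p‖ = 1) (x : ι → EuclideanSpace ℝ (Fin 3))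
    (hx : ∀ i ∈ S, ‖x i‖ = 1) :
    0 ≤ ∑ i ∈ S, ∑ j ∈ S, c i * c j *
      capQ k (⟪x i, x j⟫ - ⟪p, x i⟫ * ⟪p, x j⟫) ((1 - ⟪p, x i⟫ ^ 2) * (1 - ⟪p, x j⟫ ^ 2)) := by
  obtain ⟨b, hb⟩ := exists_orthonormalBasis_third_eq_unit hp
  -- complex coordinate of the projection to `p^⊥`
  set z : ι → ℂ := fun i => ⟨⟪b 0, x i⟫, ⟪b 1, x i⟫⟩ with hz
  have hpar : ∀ y y' : EuclideanSpace ℝ (Fin 3),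
      ⟪y, y'⟫ = ⟪b 0, y⟫ * ⟪b 0, y'⟫ + ⟪b 1, y⟫ * ⟪b 1, y'⟫ + ⟪p, y⟫ * ⟪p, y'⟫ := by
    intro y y'
    have h := b.sum_inner_mul_inner y y'
    rw [Fin.sum_univ_three, hb] at h
    rw [← h, real_inner_comm y (b 0), real_inner_comm y (b 1), real_inner_comm y p]
  have hre : ∀ i j, ((starRingEnd ℂ) (z i) * z j).re = ⟪x i, x j⟫ - ⟪p, x i⟫ * ⟪p, x j⟫ := by
    intro i j
    rw [hpar (x i) (x j)]
    simp [hz, Complex.mul_re]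
  have hns : ∀ i ∈ S, Complex.normSq (z i) = 1 - ⟪p, x i⟫ ^ 2 := by
    intro i hi
    have h1 : ⟪x i, x i⟫ = 1 := by
      rw [real_inner_self_eq_norm_sq, hx i hi]; norm_num
    have h2 := hpar (x i) (x i)
    rw [h1] at h2
    simp only [hz, Complex.normSq_mk]
    nlinarith [h2]
  have h := sum_sum_capQ_conj_mul_nonneg k S c z
  refine h.trans_eq (Finset.sum_congr rfl fun i hi => Finset.sum_congr rfl fun j hj => ?_)
  rw [hre i j, hns i hi, hns j hj]

/-- **The Gram constraint** for a unit pole `p` and unit vectors `x, y`: with `u = ⟪p,x⟫`,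
`v = ⟪p,y⟫`, `t = ⟪x,y⟫`, `1 + 2uvt − u² − v² − t² ≥ 0` (it is `(1−u²)(1−v²) − (t−uv)² = δ² ≥ 0`).
[folklore] -/
theorem gram_nonneg {p x y : EuclideanSpace ℝ (Fin 3)} (hp : ‖p‖ = 1) (hx : ‖x‖ = 1)
    (hy : ‖y‖ = 1) :
    0 ≤ 1 + 2 * ⟪p, x⟫ * ⟪p, y⟫ * ⟪x, y⟫ - ⟪p, x⟫ ^ 2 - ⟪p, y⟫ ^ 2 - ⟪x, y⟫ ^ 2 := by
  obtain ⟨b, hb⟩ := exists_orthonormalBasis_third_eq_unit hp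
  have hpar : ∀ w w' : EuclideanSpace ℝ (Fin 3),
      ⟪w, w'⟫ = ⟪b 0, w⟫ * ⟪b 0, w'⟫ + ⟪b 1, w⟫ * ⟪b 1, w'⟫ + ⟪p, w⟫ * ⟪p, w'⟫ := by
    intro w w'
    have h := b.sum_inner_mul_inner w w'
    rw [Fin.sum_univ_three, hb] at h
    rw [← h, real_inner_comm w (b 0), real_inner_comm w (b 1), real_inner_comm w p]
  have hxx : ⟪x, x⟫ = 1 := by rw [real_inner_self_eq_norm_sq, hx]; norm_num
  have hyy : ⟪y, y⟫ = 1 := by rw [real_inner_self_eq_norm_sq, hy]; norm_num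
  have h1 := hpar x x
  have h2 := hpar y y
  have h3 := hpar x y
  rw [hxx] at h1
  rw [hyy] at h2
  set a := ⟪b 0, x⟫; set a' := ⟪b 0, y⟫; set c := ⟪b 1, x⟫; set c' := ⟪b 1, y⟫
  set u := ⟪p, x⟫; set v := ⟪p, y⟫
  have key : 1 + 2 * u * v * ⟪x, y⟫ - u ^ 2 - v ^ 2 - ⟪x, y⟫ ^ 2 = (a * c' - c * a') ^ 2 := by
    rw [h3]; nlinarith [h1, h2]
  rw [key]; exact sq_nonneg _

end Summit.AtomisticToContinuum.Crystallization.Theorems.Cap
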